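import Summits.AnomalousDissipation.AnomalousDissipation.Theorems.MomentParityResolvedDissipationStubLimitSSSPrep
import Mathlib.Topology.ContinuousMap.Weierstrass

/-!
# `MomentParity.ResolvedDissipation` (stmt-AnomalousDissipation-14284), line `lions-l4-domination`,
# stub K2b — helper II: finite enstrophy and shell energy inequalities of Galerkin limits

Support file (all results proved) for `stub_limitIsStationarySolution`: the clauses (1.29) and (1.31)
of FMRT IV Def. 1.3 for a limit `μ_∞` of admissible laws `μ_i` (levels `N_i`, ball `R`, `ν > 0`,
`f ∈ L²`) in the sense of the extraction stub K2a (bounded-continuous convergence, lsc portmanteau).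

* `lintegral_eGradNormSq_limit_le` — (1.29): `∫‖∇u‖² dμ_∞ ≤ ‖f‖₂R/ν` (energy row at each level,
  lower semicontinuity of the enstrophy on `H`, portmanteau);
* `weightedEnergyIneq_limit` — for a continuous bounded weight `w ≥ 0` with weighted energy rows
  `∫ w(|u|²)[(u,f) - ν‖∇u‖²] dμ_i = 0`: `ν ∫ w(|u|²)‖∇u‖² dμ_∞ ≤ ∫ w(|u|²)(u,f) dμ_∞` (the injection
  side is a bounded continuous observable on the ball, the weighted enstrophy is lsc);
* `setIntegral_nonpos_of_polynomial_weights` — from `∫ p(|u|²) F dμ ≤ 0` for polynomials `p ≥ 0` on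
  `[0, R²]` to `∫_T F dμ ≤ 0` for sets `T` whose indicator is a pointwise limit of continuous ramps
  `0 ≤ w_n ≤ 1` of `|u|²` (Weierstrass on `[0, R²]`, dominated convergence);
* `exists_shellWeights` — continuous ramps converging to the indicator of an energy shell
  `{e₁ ≤ |u|² < e₂}`, `e₁ < e₂` in `[0, ∞]`.
-/

noncomputable section

-- `Summit.<Summit>.<Problem>`: single-conjunct summit, the duplicate namespace segment is mandated.
set_option linter.dupNamespace false

namespace Summit.AnomalousDissipation.AnomalousDissipation.Theorems.MomentParityResolvedDissipation.LimitSSS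

open MeasureTheory Filter Topology
open scoped ENNReal NNReal InnerProductSpace RealInnerProductSpace
open Literature.Analysis.FunctionSpaces Literature.Analysis.FluidPDE
open Summit.AnomalousDissipation.AnomalousDissipation.Theses.MomentParity
open Summit.AnomalousDissipation.AnomalousDissipation.Theorems.QuarticGate.Negative

/-! ## (1.29) Finite enstrophy of the limit -/

/-- **(1.29) for the limit**: the mean enstrophy of the limit law is bounded by the common budget
`‖f‖₂ R / ν` of the approximating admissible laws (energy row `ν∫‖∇u‖² = ∫(f,u) ≤ ‖f‖₂ R` at each level,
`ensembleDissipation_eq_of_polyStationary`; `u ↦ ‖∇u‖²` is lower semicontinuous on `H`, portmanteau).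
This is where `0 < ν` enters. [folklore] -/
theorem lintegral_eGradNormSq_limit_le :
    ∀ (ν : ℝ) (f : UnitAddTorus (Fin 3) → EuclideanSpace ℝ (Fin 3)) (R : ℝ), 0 < ν → MemLp f 2 volume →
    ∀ (Nl : ℕ → ℕ) (μ : ℕ → Measure (Torus.energySpace (Fin 3))),
      (∀ i, IsProbabilityMeasure (μ i)) → (∀ i, ∀ᵐ u ∂(μ i), IsLevel (Nl i) u) →
      (∀ i, ∀ᵐ u ∂(μ i), ‖u‖ ≤ R) → (∀ i (d : ℕ), IsPolyStationary ν f (Nl i) d (μ i)) →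
    ∀ μlim : Measure (Torus.energySpace (Fin 3)),
      (∀ G : Torus.energySpace (Fin 3) → ℝ≥0∞, LowerSemicontinuous G →
          ∫⁻ u, G u ∂μlim ≤ Filter.liminf (fun i => ∫⁻ u, G u ∂(μ i)) atTop) →
      ∫⁻ u, Torus.eGradNormSq (u.1 : UnitAddTorus (Fin 3) → EuclideanSpace ℝ (Fin 3)) ∂μlim ≤
        ((Real.sqrt (∫ x, ‖f x‖ ^ 2) * R / ν).toNNReal : ℝ≥0∞) := by
  intro ν f R hν hf Nl μ hp hl hb hs μlim hLSC
  -- the `N`-uniform budget `∫⁻ ‖∇u‖² dμ_i ≤ ‖f‖₂ R / ν` (energy row + Cauchy–Schwarz)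
  have hbudget : ∀ i, Torus.ensembleEnstrophy (μ i) ≤ ((Real.sqrt (∫ x, ‖f x‖ ^ 2) * R / ν).toNNReal : ℝ≥0∞) := by
    intro i
    haveI := hp i
    haveI : (ae (μ i)).NeBot := ae_neBot.2 (IsProbabilityMeasure.ne_zero (μ i))
    obtain ⟨u₀, hu₀⟩ := (hb i).exists
    have hR0 : 0 ≤ R := (norm_nonneg _).trans hu₀
    have h2 : Integrable (fun u : Torus.energySpace (Fin 3) => ‖u‖ ^ 2) (μ i) :=
      Integrable.of_bound (continuous_norm.pow 2).aestronglyMeasurable (R ^ 2) ((hb i).mono fun u hu => by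
        rw [Real.norm_eq_abs, abs_of_nonneg (by positivity)]
        exact pow_le_pow_left₀ (norm_nonneg _) hu 2)
    have hE : Torus.ensembleEnergy (μ i) ≤ R ^ 2 := by
      unfold Torus.ensembleEnergy
      calc ∫ u, ‖u‖ ^ 2 ∂(μ i) ≤ ∫ _u, R ^ 2 ∂(μ i) := integral_mono_ae h2 (integrable_const _)
            ((hb i).mono fun u hu => pow_le_pow_left₀ (norm_nonneg _) hu 2)
        _ = R ^ 2 := by simp
    have hdiss : Torus.ensembleDissipation ν (μ i) ≤ Real.sqrt (∫ x, ‖f x‖ ^ 2) * R := by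
      rw [ensembleDissipation_eq_of_polyStationary f hf (hl i) h2 le_rfl (hs i 3)]
      refine (Theorems.CubicParityLoud.Negative.integral_pairing_le hf h2).trans ?_
      gcongr
      calc Real.sqrt (Torus.ensembleEnergy (μ i)) ≤ Real.sqrt (R ^ 2) := Real.sqrt_le_sqrt hE
        _ = R := Real.sqrt_sq hR0
    have hne : Torus.ensembleEnstrophy (μ i) ≠ ⊤ := by
      have h1 := ensembleEnstrophy_le_of_level (hl i)
      have h3 : ∫⁻ u : Torus.energySpace (Fin 3), ‖u‖ₑ ^ 2 ∂(μ i) ≤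
          ∫⁻ _u : Torus.energySpace (Fin 3), ENNReal.ofReal (R ^ 2) ∂(μ i) :=
        lintegral_mono_ae ((hb i).mono fun u hu => by
          rw [← ofReal_norm, ← ENNReal.ofReal_pow (norm_nonneg _)]
          exact ENNReal.ofReal_le_ofReal (pow_le_pow_left₀ (norm_nonneg _) hu 2))
      rw [lintegral_const, measure_univ, mul_one] at h3
      exact ne_top_of_le_ne_top
        (ENNReal.mul_ne_top ENNReal.ofReal_ne_top (ne_top_of_le_ne_top ENNReal.ofReal_ne_top h3)) h1
    unfold Torus.ensembleDissipation at hdiss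
    rw [← ENNReal.ofReal_toReal hne]
    refine ENNReal.ofReal_le_ofReal ?_
    rw [le_div_iff₀ hν, mul_comm]
    exact hdiss
  exact (hLSC _ Torus.lowerSemicontinuous_eGradNormSq_coe).trans
    (Filter.liminf_le_of_frequently_le' (Frequently.of_forall fun i =>
      show Torus.ensembleEnstrophy (μ i) ≤ _ from hbudget i))

/-! ## (1.31) Weighted energy inequalities of the limit -/

section Limit

variable {ν : ℝ} {f : UnitAddTorus (Fin 3) → EuclideanSpace ℝ (Fin 3)} {R : ℝ} {Nl : ℕ → ℕ}
  {μ : ℕ → Measure (Torus.energySpace (Fin 3))} {μlim : Measure (Torus.energySpace (Fin 3))}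

/-- **Weighted mean energy inequality of the limit.** For a continuous bounded weight `w ≥ 0` whose
weighted energy rows `∫ w(|u|²)[(u,f) - ν‖∇u‖²] dμ_i = 0` hold along the admissible sequence,
the limit law satisfies `ν ∫ w(|u|²)‖∇u‖² dμ_∞ ≤ ∫ w(|u|²)(u,f) dμ_∞`: the injection side is a bounded
norm-continuous observable on the ball, the enstrophy side is lower semicontinuous (`ν > 0`). [folklore] -/
theorem weightedEnergyIneq_limit (hν : 0 < ν) (hf : MemLp f 2 volume)
    (hp : ∀ i, IsProbabilityMeasure (μ i)) (hl : ∀ i, ∀ᵐ u ∂(μ i), IsLevel (Nl i) u)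
    (hb : ∀ i, ∀ᵐ u ∂(μ i), ‖u‖ ≤ R) [IsProbabilityMeasure μlim] (hblim : ∀ᵐ u ∂μlim, ‖u‖ ≤ R)
    (hBC : ∀ g : Torus.energySpace (Fin 3) → ℝ, Continuous g → (∃ B : ℝ, ∀ u, |g u| ≤ B) →
      Tendsto (fun i => ∫ u, g u ∂(μ i)) atTop (𝓝 (∫ u, g u ∂μlim)))
    (hLSC : ∀ G : Torus.energySpace (Fin 3) → ℝ≥0∞, LowerSemicontinuous G →
      ∫⁻ u, G u ∂μlim ≤ Filter.liminf (fun i => ∫⁻ u, G u ∂(μ i)) atTop)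
    (hfin : ∫⁻ u, Torus.eGradNormSq (u.1 : UnitAddTorus (Fin 3) → EuclideanSpace ℝ (Fin 3)) ∂μlim ≠ ⊤)
    {w : ℝ → ℝ} (hw : Continuous w) (hw0 : ∀ s, 0 ≤ w s) {B : ℝ} (hwB : ∀ s, w s ≤ B)
    (hrow : ∀ i, ∫ u, w (‖u‖ ^ 2) * (Torus.pairing u.1 f -
      ν * (Torus.eGradNormSq (u.1 : UnitAddTorus (Fin 3) → EuclideanSpace ℝ (Fin 3))).toReal) ∂(μ i) = 0) :
    ν * ∫ u, w (‖u‖ ^ 2) *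
        (Torus.eGradNormSq (u.1 : UnitAddTorus (Fin 3) → EuclideanSpace ℝ (Fin 3))).toReal ∂μlim ≤
      ∫ u, w (‖u‖ ^ 2) * Torus.pairing u.1 f ∂μlim := by
  set Z : Torus.energySpace (Fin 3) → ℝ := fun u =>
    (Torus.eGradNormSq (u.1 : UnitAddTorus (Fin 3) → EuclideanSpace ℝ (Fin 3))).toReal with hZ
  have hB0 : 0 ≤ B := (hw0 0).trans (hwB 0)
  have hwabs : ∀ s, |w s| ≤ B := fun s => by rw [abs_of_nonneg (hw0 s)]; exact hwB s
  have hwc : Continuous fun u : Torus.energySpace (Fin 3) => w (‖u‖ ^ 2) := hw.comp (continuous_norm.pow 2)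
  haveI : (ae μlim).NeBot := ae_neBot.2 (IsProbabilityMeasure.ne_zero μlim)
  have hR0 : 0 ≤ R := by
    obtain ⟨u, hu⟩ := hblim.exists
    exact (norm_nonneg u).trans hu
  -- (i) the injection side is a bounded continuous observable on the ball
  set M : ℝ := R * ‖hf.toLp f‖ with hM
  have hM0 : 0 ≤ M := by positivity
  set h : Torus.energySpace (Fin 3) → ℝ := fun u =>
    w (‖u‖ ^ 2) * max (-M) (min M (Torus.pairing u.1 f)) with hh
  have hhc : Continuous h :=
    hwc.mul (continuous_const.max (continuous_const.min (Torus.continuous_pairing_coe hf)))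
  have hhB : ∀ u, |h u| ≤ B * M := fun u => by
    rw [hh, abs_mul]
    exact mul_le_mul (hwabs _) (abs_le.2 ⟨le_max_left _ _, max_le (by linarith) (min_le_left _ _)⟩)
      (abs_nonneg _) hB0
  have hheq : ∀ u : Torus.energySpace (Fin 3), ‖u‖ ≤ R → h u = w (‖u‖ ^ 2) * Torus.pairing u.1 f := by
    intro u hu
    have h1 : |Torus.pairing u.1 f| ≤ M :=
      (Torus.abs_pairing_coe_le hf u).trans (mul_le_mul_of_nonneg_right hu (norm_nonneg _))
    obtain ⟨h1a, h1b⟩ := abs_le.1 h1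
    simp only [hh]
    rw [min_eq_right h1b, max_eq_right h1a]
  have ha : Tendsto (fun i => ∫ u, w (‖u‖ ^ 2) * Torus.pairing u.1 f ∂(μ i)) atTop
      (𝓝 (∫ u, w (‖u‖ ^ 2) * Torus.pairing u.1 f ∂μlim)) := by
    have h1 := hBC h hhc ⟨B * M, hhB⟩
    rw [integral_congr_ae (hblim.mono fun u hu => hheq u hu)] at h1
    exact h1.congr fun i => integral_congr_ae ((hb i).mono fun u hu => hheq u hu)
  -- (ii) the rows: `∫ w (u,f) dμ_i = ν ∫ w ‖∇u‖² dμ_i ≥ 0`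
  have hwZint : ∀ i, Integrable (fun u => w (‖u‖ ^ 2) * Z u) (μ i) := by
    intro i
    haveI := hp i
    refine Integrable.mono' (integrable_const (B * (4 * Real.pi ^ 2 * (Nl i : ℝ) ^ 2 * R ^ 2)))
      (hwc.aestronglyMeasurable.mul Torus.measurable_eGradNormSq_coe.ennreal_toReal.aestronglyMeasurable) ?_
    filter_upwards [hl i, hb i] with u hu huR
    rw [norm_mul, Real.norm_eq_abs, Real.norm_eq_abs, abs_of_nonneg ENNReal.toReal_nonneg]
    refine mul_le_mul (hwabs _) ?_ ENNReal.toReal_nonneg hB0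
    refine ENNReal.toReal_le_of_le_ofReal (by positivity)
      ((Theorems.CubicParityLoud.Negative.eGradNormSq_le_of_isLevel hu).trans (ENNReal.ofReal_le_ofReal ?_))
    gcongr
  have hwPint : ∀ i, Integrable (fun u => w (‖u‖ ^ 2) * Torus.pairing u.1 f) (μ i) := by
    intro i
    haveI := hp i
    refine Integrable.mono' (integrable_const (B * M))
      (hwc.aestronglyMeasurable.mul (Torus.continuous_pairing_coe hf).aestronglyMeasurable) ?_
    filter_upwards [hb i] with u hu
    rw [← hheq u hu, Real.norm_eq_abs]
    exact hhB u
  have hab : ∀ i, ∫ u, w (‖u‖ ^ 2) * Torus.pairing u.1 f ∂(μ i) = ν * ∫ u, w (‖u‖ ^ 2) * Z u ∂(μ i) := by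
    intro i
    have h1 := hrow i
    have hsplit : (fun u : Torus.energySpace (Fin 3) => w (‖u‖ ^ 2) * (Torus.pairing u.1 f - ν * Z u)) =
        fun u => w (‖u‖ ^ 2) * Torus.pairing u.1 f - ν * (w (‖u‖ ^ 2) * Z u) := by
      funext u; ring
    rw [hsplit, integral_sub (hwPint i) ((hwZint i).const_mul ν), integral_const_mul] at h1
    linarith
  -- (iii) the enstrophy side is lower semicontinuous
  set G : Torus.energySpace (Fin 3) → ℝ≥0∞ := fun u => ENNReal.ofReal (w (‖u‖ ^ 2)) *
    Torus.eGradNormSq (u.1 : UnitAddTorus (Fin 3) → EuclideanSpace ℝ (Fin 3)) with hG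
  have hGlsc : LowerSemicontinuous G :=
    lowerSemicontinuous_mul_eGradNormSq (ENNReal.continuous_ofReal.comp hwc) fun u => ENNReal.ofReal_ne_top
  have hGi : ∀ i, ∫⁻ u, G u ∂(μ i) = ENNReal.ofReal (∫ u, w (‖u‖ ^ 2) * Z u ∂(μ i)) := by
    intro i
    have hae : ∀ᵐ u ∂(μ i), G u = ENNReal.ofReal (w (‖u‖ ^ 2) * Z u) := (hl i).mono fun u hu => by
      simp only [hG, hZ]
      rw [ENNReal.ofReal_mul (hw0 _), ENNReal.ofReal_toReal
        (Theorems.CubicParityLoud.Negative.eGradNormSq_lt_top_of_isLevel hu).ne]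
    rw [lintegral_congr_ae hae, ← ofReal_integral_eq_lintegral_ofReal (hwZint i)
      (ae_of_all _ fun u => mul_nonneg (hw0 _) ENNReal.toReal_nonneg)]
  have hZint : Integrable Z μlim :=
    integrable_toReal_of_lintegral_ne_top Torus.measurable_eGradNormSq_coe.aemeasurable hfin
  have hwZ : Integrable (fun u => w (‖u‖ ^ 2) * Z u) μlim :=
    hZint.bdd_mul hwc.aestronglyMeasurable (ae_of_all _ fun u => by
      rw [Real.norm_eq_abs]; exact hwabs _)
  have hGlim : ∫⁻ u, G u ∂μlim = ENNReal.ofReal (∫ u, w (‖u‖ ^ 2) * Z u ∂μlim) := by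
    have hae : ∀ᵐ u ∂μlim, G u = ENNReal.ofReal (w (‖u‖ ^ 2) * Z u) :=
      (ae_lt_top Torus.measurable_eGradNormSq_coe hfin).mono fun u hu => by
        simp only [hG, hZ]
        rw [ENNReal.ofReal_mul (hw0 _), ENNReal.ofReal_toReal hu.ne]
    rw [lintegral_congr_ae hae, ← ofReal_integral_eq_lintegral_ofReal hwZ
      (ae_of_all _ fun u => mul_nonneg (hw0 _) ENNReal.toReal_nonneg)]
  -- (iv) portmanteau
  set a : ℝ := ∫ u, w (‖u‖ ^ 2) * Torus.pairing u.1 f ∂μlim with ha_def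
  have hlim : Tendsto (fun i => ∫⁻ u, G u ∂(μ i)) atTop (𝓝 (ENNReal.ofReal (a / ν))) := by
    have h1 : (fun i => ∫⁻ u, G u ∂(μ i)) =
        fun i => ENNReal.ofReal ((∫ u, w (‖u‖ ^ 2) * Torus.pairing u.1 f ∂(μ i)) / ν) := by
      funext i
      rw [hGi i, hab i, mul_div_cancel_left₀ _ hν.ne']
    rw [h1]
    exact ENNReal.tendsto_ofReal (ha.div_const ν)
  have hle : ∫⁻ u, G u ∂μlim ≤ ENNReal.ofReal (a / ν) := (hLSC G hGlsc).trans (le_of_eq hlim.liminf_eq)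
  have ha0 : 0 ≤ a := by
    refine ge_of_tendsto' ha fun i => ?_
    rw [hab i]
    exact mul_nonneg hν.le (integral_nonneg fun u => mul_nonneg (hw0 _) ENNReal.toReal_nonneg)
  rw [hGlim] at hle
  have h3 : ∫ u, w (‖u‖ ^ 2) * Z u ∂μlim ≤ a / ν :=
    (ENNReal.ofReal_le_ofReal_iff (div_nonneg ha0 hν.le)).1 hle
  calc ν * ∫ u, w (‖u‖ ^ 2) * Z u ∂μlim ≤ ν * (a / ν) := mul_le_mul_of_nonneg_left h3 hν.le
    _ = a := mul_div_cancel₀ _ hν.ne'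

end Limit

/-- **From polynomially weighted inequalities to sharp shells.** Let `μ` be a finite law on `H`
carried by the ball `‖u‖ ≤ R` and `F` integrable with `∫ p(|u|²) F dμ ≤ 0` for every real polynomial
`p ≥ 0` on `[0, R²]` (the argument clamped to `[0, R²]`). If continuous weights `0 ≤ w_n ≤ 1`
converge pointwise on the ball to the indicator of a measurable set `T` (as functions of `|u|²`),
then `∫_T F dμ ≤ 0` (Weierstrass approximation on `[0, R²]` and dominated convergence). [folklore] -/
theorem setIntegral_nonpos_of_polynomial_weights {μ : Measure (Torus.energySpace (Fin 3))}
    [IsFiniteMeasure μ] {R : ℝ} (hμR : ∀ᵐ u ∂μ, ‖u‖ ≤ R) {F : Torus.energySpace (Fin 3) → ℝ}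
    (hF : Integrable F μ)
    (hpoly : ∀ p : Polynomial ℝ, (∀ s ∈ Set.Icc (0 : ℝ) (R ^ 2), 0 ≤ p.eval s) →
      ∫ u, p.eval (max 0 (min (‖u‖ ^ 2) (R ^ 2))) * F u ∂μ ≤ 0)
    {T : Set (Torus.energySpace (Fin 3))} (hT : MeasurableSet T) (w : ℕ → ℝ → ℝ)
    (hwc : ∀ n, Continuous (w n)) (hw01 : ∀ n s, 0 ≤ w n s ∧ w n s ≤ 1)
    (hwlim : ∀ u : Torus.energySpace (Fin 3), ‖u‖ ≤ R →
      Tendsto (fun n => w n (‖u‖ ^ 2)) atTop (𝓝 (T.indicator 1 u))) :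
    ∫ u in T, F u ∂μ ≤ 0 := by
  -- polynomial approximants of the weights, nonnegative on `[0, R²]`
  have hex : ∀ n : ℕ, ∃ p : Polynomial ℝ, (∀ s ∈ Set.Icc (0 : ℝ) (R ^ 2), 0 ≤ p.eval s) ∧
      ∀ s ∈ Set.Icc (0 : ℝ) (R ^ 2), |p.eval s - w n s| ≤ 2 * (1 / ((n : ℝ) + 1)) := by
    intro n
    have hε : (0 : ℝ) < 1 / ((n : ℝ) + 1) := by positivity
    obtain ⟨q, hq⟩ := exists_polynomial_near_of_continuousOn 0 (R ^ 2) (w n) (hwc n).continuousOn _ hε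
    refine ⟨q + Polynomial.C (1 / ((n : ℝ) + 1)), fun s hs => ?_, fun s hs => ?_⟩
    · have h := abs_lt.1 (hq s hs)
      rw [Polynomial.eval_add, Polynomial.eval_C]
      linarith [(hw01 n s).1, h.1]
    · have h := abs_lt.1 (hq s hs)
      rw [Polynomial.eval_add, Polynomial.eval_C, abs_le]
      constructor <;> linarith [h.1, h.2]
  choose p hp0 hpw using hex
  set clamp : Torus.energySpace (Fin 3) → ℝ := fun u => max 0 (min (‖u‖ ^ 2) (R ^ 2)) with hclamp
  have hclamp_mem : ∀ u, clamp u ∈ Set.Icc (0 : ℝ) (R ^ 2) := fun u =>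
    ⟨le_max_left _ _, max_le (sq_nonneg R) (min_le_right _ _)⟩
  have hclamp_eq : ∀ u : Torus.energySpace (Fin 3), ‖u‖ ≤ R → clamp u = ‖u‖ ^ 2 := fun u hu => by
    have h1 : ‖u‖ ^ 2 ≤ R ^ 2 := pow_le_pow_left₀ (norm_nonneg _) hu 2
    simp only [hclamp]
    rw [min_eq_left h1, max_eq_right (sq_nonneg _)]
  have hclamp_c : Continuous clamp := continuous_const.max ((continuous_norm.pow 2).min continuous_const)
  -- dominated convergence
  set Fn : ℕ → Torus.energySpace (Fin 3) → ℝ := fun n u => (p n).eval (clamp u) * F u with hFn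
  have hFn_le : ∀ n, ∫ u, Fn n u ∂μ ≤ 0 := fun n => hpoly (p n) (hp0 n)
  have hmeas : ∀ n, AEStronglyMeasurable (Fn n) μ := fun n =>
    ((p n).continuous.comp hclamp_c).aestronglyMeasurable.mul hF.1
  have hbound : ∀ n, ∀ᵐ u ∂μ, ‖Fn n u‖ ≤ 3 * ‖F u‖ := fun n => ae_of_all _ fun u => by
    simp only [hFn]
    rw [norm_mul]
    refine mul_le_mul_of_nonneg_right ?_ (norm_nonneg _)
    have h1 := abs_le.1 (hpw n (clamp u) (hclamp_mem u))
    have h2 := hw01 n (clamp u)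
    have h3 : 1 / ((n : ℝ) + 1) ≤ 1 := by
      rw [div_le_one (by positivity)]
      linarith [n.cast_nonneg (α := ℝ)]
    rw [Real.norm_eq_abs, abs_le]
    constructor <;> linarith [h2.1, h2.2, h1.1, h1.2]
  have hlim : ∀ᵐ u ∂μ, Tendsto (fun n => Fn n u) atTop (𝓝 (T.indicator F u)) := hμR.mono fun u hu => by
    have h1 : Tendsto (fun n => (p n).eval (clamp u) - w n (‖u‖ ^ 2)) atTop (𝓝 0) := by
      have h0 : Tendsto (fun n : ℕ => 2 * (1 / ((n : ℝ) + 1))) atTop (𝓝 0) := by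
        have h := (tendsto_one_div_add_atTop_nhds_zero_nat (𝕜 := ℝ)).const_mul 2
        rwa [mul_zero] at h
      refine squeeze_zero_norm (fun n => ?_) h0
      rw [Real.norm_eq_abs, hclamp_eq u hu]
      exact hpw n (‖u‖ ^ 2) (by rw [← hclamp_eq u hu]; exact hclamp_mem u)
    have h2 := h1.add (hwlim u hu)
    simp only [sub_add_cancel, zero_add] at h2
    have h3 := h2.mul_const (F u)
    show Tendsto (fun n => (p n).eval (clamp u) * F u) atTop (𝓝 (T.indicator F u))
    convert h3 using 2
    by_cases huT : u ∈ T
    · simp [Set.indicator_of_mem huT]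
    · simp [Set.indicator_of_notMem huT]
  have hconv := tendsto_integral_of_dominated_convergence (fun u => 3 * ‖F u‖) hmeas
    (hF.norm.const_mul 3) hbound hlim
  rw [integral_indicator hT] at hconv
  exact le_of_tendsto' hconv hFn_le

/-- **Continuous ramps converging to the indicator of an energy shell.** For `e₁ < e₂` in `[0, ∞]`
there are continuous `w_n : ℝ → [0, 1]` with `w_n(s) → 1_{e₁ ≤ s < e₂}` for every real `s ≥ 0`
(read in `[0, ∞]` through `ENNReal.ofReal`): products of piecewise linear ramps. [folklore] -/
theorem exists_shellWeights {e₁ e₂ : ℝ≥0∞} (h : e₁ < e₂) :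
    ∃ w : ℕ → ℝ → ℝ, (∀ n, Continuous (w n)) ∧ (∀ n s, 0 ≤ w n s ∧ w n s ≤ 1) ∧
      ∀ s : ℝ, 0 ≤ s → Tendsto (fun n => w n s) atTop
        (𝓝 (if e₁ ≤ ENNReal.ofReal s ∧ ENNReal.ofReal s < e₂ then 1 else 0)) := by
  have he₁ : e₁ ≠ ⊤ := ne_top_of_lt h
  -- ramps: `ramp t = max 0 (min 1 t)`
  have hramp01 : ∀ t : ℝ, 0 ≤ max 0 (min 1 t) ∧ max 0 (min 1 t) ≤ 1 := fun t =>
    ⟨le_max_left _ _, max_le zero_le_one (min_le_left _ _)⟩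
  have hrampc : Continuous fun t : ℝ => max 0 (min 1 t) := continuous_const.max (continuous_const.min continuous_id)
  have hramp_one : ∀ t : ℝ, 1 ≤ t → max 0 (min 1 t) = 1 := fun t ht => by
    rw [min_eq_left ht, max_eq_right zero_le_one]
  have hramp_zero : ∀ t : ℝ, t ≤ 0 → max 0 (min 1 t) = 0 := fun t ht => by
    rw [min_eq_right (ht.trans zero_le_one), max_eq_left ht]
  -- the lower ramp `A n s → 1_{e₁ ≤ s}`
  set A : ℕ → ℝ → ℝ := fun n s => max 0 (min 1 ((n : ℝ) * (s - e₁.toReal) + 1)) with hA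
  have hAc : ∀ n, Continuous (A n) := fun n =>
    hrampc.comp ((continuous_const.mul (continuous_id.sub continuous_const)).add continuous_const)
  have hAlim : ∀ s : ℝ, 0 ≤ s → Tendsto (fun n => A n s) atTop
      (𝓝 (if e₁ ≤ ENNReal.ofReal s then 1 else 0)) := by
    intro s hs
    by_cases hle : e₁ ≤ ENNReal.ofReal s
    · have hle' : e₁.toReal ≤ s := (ENNReal.le_ofReal_iff_toReal_le he₁ hs).1 hle
      rw [if_pos hle]
      refine tendsto_const_nhds.congr fun n => ?_
      simp only [hA]
      rw [hramp_one _ (by nlinarith [n.cast_nonneg (α := ℝ)])]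
    · have hlt : s < e₁.toReal := by
        rw [ENNReal.le_ofReal_iff_toReal_le he₁ hs, not_le] at hle
        exact hle
      rw [if_neg hle]
      obtain ⟨n₀, hn₀⟩ := exists_nat_ge (1 / (e₁.toReal - s))
      refine tendsto_const_nhds.congr' ?_
      filter_upwards [eventually_ge_atTop n₀] with n hn
      have hgap : 0 < e₁.toReal - s := by linarith
      have h1 : 1 ≤ (n : ℝ) * (e₁.toReal - s) := by
        have hn' : (n₀ : ℝ) ≤ n := by exact_mod_cast hn
        rw [div_le_iff₀ hgap] at hn₀
        nlinarith
      simp only [hA]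
      rw [hramp_zero _ (by nlinarith)]
  rcases eq_or_ne e₂ ⊤ with he₂ | he₂
  · refine ⟨A, hAc, fun n s => hramp01 _, fun s hs => ?_⟩
    simp only [he₂, ENNReal.ofReal_lt_top, and_true]
    exact hAlim s hs
  · -- the upper ramp `B n s → 1_{s < e₂}`
    set Bf : ℕ → ℝ → ℝ := fun n s => max 0 (min 1 ((n : ℝ) * (e₂.toReal - s))) with hBf
    have hBc : ∀ n, Continuous (Bf n) := fun n =>
      hrampc.comp (continuous_const.mul (continuous_const.sub continuous_id))
    have hBlim : ∀ s : ℝ, 0 ≤ s → Tendsto (fun n => Bf n s) atTop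
        (𝓝 (if ENNReal.ofReal s < e₂ then 1 else 0)) := by
      intro s hs
      by_cases hlt : ENNReal.ofReal s < e₂
      · have hlt' : s < e₂.toReal := (ENNReal.ofReal_lt_iff_lt_toReal hs he₂).1 hlt
        rw [if_pos hlt]
        obtain ⟨n₀, hn₀⟩ := exists_nat_ge (1 / (e₂.toReal - s))
        refine tendsto_const_nhds.congr' ?_
        filter_upwards [eventually_ge_atTop n₀] with n hn
        have hgap : 0 < e₂.toReal - s := by linarith
        have h1 : 1 ≤ (n : ℝ) * (e₂.toReal - s) := by
          have hn' : (n₀ : ℝ) ≤ n := by exact_mod_cast hn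
          rw [div_le_iff₀ hgap] at hn₀
          nlinarith
        simp only [hBf]
        rw [hramp_one _ h1]
      · have hle : e₂.toReal ≤ s := by
          rw [ENNReal.ofReal_lt_iff_lt_toReal hs he₂, not_lt] at hlt
          exact hlt
        rw [if_neg hlt]
        refine tendsto_const_nhds.congr fun n => ?_
        simp only [hBf]
        rw [hramp_zero _ (by nlinarith [n.cast_nonneg (α := ℝ)])]
    refine ⟨fun n s => A n s * Bf n s, fun n => (hAc n).mul (hBc n),
      fun n s => ⟨mul_nonneg (hramp01 _).1 (hramp01 _).1,
        mul_le_one₀ (hramp01 _).2 (hramp01 _).1 (hramp01 _).2⟩, fun s hs => ?_⟩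
    have hprod := (hAlim s hs).mul (hBlim s hs)
    convert hprod using 2
    by_cases h1 : e₁ ≤ ENNReal.ofReal s <;> by_cases h2 : ENNReal.ofReal s < e₂ <;> simp [h1, h2]

end Summit.AnomalousDissipation.AnomalousDissipation.Theorems.MomentParityResolvedDissipation.LimitSSS

end
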